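import Summits.QuantumFields.YangMills.Theses.LimitSetRigidity

/-!
# Assembly of route `LimitSetRigidity` (rung R3 of LADDER-YM, leaf `T3YM3TorusStatement.YM3TorusSU2`; item stmt-QuantumFields-27353)

The route file's kernel-checked deciding theorem `closes` (Ostrowski's principle: `SlowVariationL` makes the set of
subsequential limit functionals connected in the test coordinates, `IsolatedLimitPointsL` makes it discrete; planner
ym-r3-idea-1 g5) packaged as the proof of the route's `Assembly` item
`IsolatedLimitPointsL → SlowVariationL → YM3TorusSU2`.  No summit and no Clay statement is proved here; the rung `YM3TorusSU2`
(a RECORD rung) stays open behind the route's two open cruxes (stmt-QuantumFields-27351, 27352).  One-line bookkeeping, closed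
only so that the ledger shows the route's open content exactly.
-/

namespace Summit.QuantumFields.YangMills.Theorems

open Summit.QuantumFields.YangMills.Theses.LimitSetRigidity in
/-- The `Assembly` item of route `LimitSetRigidity` holds: it is the route's deciding theorem `closes` read as an implication.
Nothing about the mass gap or the continuum limit is proved by this. -/
theorem limitSetRigidity_assembly : Summit.QuantumFields.YangMills.Theses.LimitSetRigidity.Assembly :=
  fun hB hA => closes hB hA

end Summit.QuantumFields.YangMills.Theorems
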